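import Mathlib

/-!
# `GrenetZeon.DualUnipotentThreeHalves` (stmt-ValiantsHypothesis-24318) — line `radical_split`, stub R1: BRICK 2a/2b,
# the LOEWY FLAG of an ideal of a matrix algebra and an ADAPTED BASIS for a descending chain of subspaces

HONEST FRAMING.  Helper file (`--supports stmt-ValiantsHypothesis-24318 --as helper`; val-lit port pool, seat
val-port-3 g0; desk g12 RULING #271 (a′) / #272 (d); line owner val-idea-9 g3, val-lit bus l.7792, confirmed the brick
order).  Second brick toward R1 `stub_radicalCoarsening` («radical coarsening»,
`Cruxes/DualUnipotentThreeHalves/Lines/radical_split.lean`, card §2), after BRICK 1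
`…RadicalCoarseningTrace` (trace form ⇒ the linear parts lie in the nilpotent Jacobson radical).  Pure linear algebra:
* §AdaptedBasis — for ANY antitone chain `F : ℕ → Submodule K V` with `F 0 = ⊤`, `F L = ⊥`: nested linearly
  independent spanning sets (`exists_nested_sets`, by `LinearIndepOn.extend`) and an ADAPTED spanning set with a level
  function (`exists_adapted_set`: `u ∈ F (lvl u)`, `lvl u ≤ L`, and `F t ≤ span {u ∈ B | t ≤ lvl u}`) — the `lvl`
  and the basis `g` that `FlagAdaptedUpTo` asks for, in set form;
* §LoewyFlag — for an ideal `J` of a subalgebra `𝒜 ⊆ M_m(ℂ)` with `J ^ L = ⊥`: the chain `F t = J^t · ℂ^m`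
  (`exists_loewy_flag`): antitone, `F 0 = ⊤`, `F L = ⊥`, stable under every element of `𝒜`, and every element of `J`
  CLIMBS (`J · F t ⊆ F (t+1)`).  (`Ideal` is Mathlib's left ideal; only left-ideal closure is used.)
What R1 still needs (recorded for the successor): (B2c) coordinates — from `exists_loewy_flag` (with
`J = Ideal.jacobson ⊥`, BRICK 1) + `exists_adapted_set`, a basis `g : GL_m(ℂ)` indexed by `Fin m` and the check of
`FlagAdapted lvl 0 0 (g·N(x + s v)·g⁻¹)` (constant part `𝒜`-stable ⇒ `lvl j ≤ lvl i`, `s`-part in `J` ⇒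
`lvl j + 1 ≤ lvl i`), giving `FlagCheap` whenever `L·n < finrank K`; (B3) the greedy coarsening for the registered
constant `16m⌊√n⌋ + 16n`.  Nothing here bears on R1 itself, on the rung `…Theses.GrenetZeon.DualUnipotentThreeHalves`,
on 24318 / 8062, or on `VP ≠ VNP` (NOT proved).  No definitions, no named facts.
[folklore] successive extension of linearly independent sets; Loewy series of a nilpotent ideal acting on a module.
-/

-- `Summit.ValiantsHypothesis.ValiantsHypothesis.…` is the tree's mandated single-conjunct layout (Sub = Summit).
set_option linter.dupNamespace false

noncomputable section

namespace Summit.ValiantsHypothesis.ValiantsHypothesis.Theorems.GrenetZeon.RadicalCoarsening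

open Submodule

section AdaptedBasis

variable {K : Type*} [Field K] {V : Type*} [AddCommGroup V] [Module K V]

/-- One extension step inside a subspace: a linearly independent subset of `W` extends to a linearly independent
subset of `W` spanning `W`. [folklore] -/
theorem exists_linearIndepOn_extend_in (W : Submodule K V) {s : Set V} (hs : LinearIndepOn K id s)
    (hsW : s ⊆ (W : Set V)) :
    ∃ b : Set V, s ⊆ b ∧ b ⊆ (W : Set V) ∧ span K b = W ∧ LinearIndepOn K id b := by
  refine ⟨hs.extend hsW, hs.subset_extend hsW, hs.extend_subset hsW, ?_, hs.linearIndepOn_extend hsW⟩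
  rw [hs.span_extend_eq_span hsW, Submodule.span_eq]

/-- **Nested spanning sets along a descending chain.**  For an antitone chain `F` with `F L = ⊥` there are sets
`S j` (`j ≤ L`), increasing in `j`, with `S j ⊆ F (L - j)`, `span (S j) = F (L - j)`, all linearly independent.
[folklore] -/
theorem exists_nested_sets (F : ℕ → Submodule K V) (hanti : Antitone F) (L : ℕ) (hL : F L = ⊥) :
    ∃ S : ℕ → Set V, (∀ j, LinearIndepOn K id (S j)) ∧ (∀ j, S j ⊆ (F (L - j) : Set V)) ∧
      (∀ j, span K (S j) = F (L - j)) ∧ (∀ j, S j ⊆ S (j + 1)) := by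
  -- build the Σ-type valued sequence by recursion
  have step : ∀ (j : ℕ) (s : Set V), LinearIndepOn K id s → s ⊆ (F (L - j) : Set V) →
      ∃ b : Set V, s ⊆ b ∧ b ⊆ (F (L - (j + 1)) : Set V) ∧ span K b = F (L - (j + 1)) ∧
        LinearIndepOn K id b := by
    intro j s hs hsF
    have hmono : (F (L - j) : Set V) ⊆ (F (L - (j + 1)) : Set V) := by
      have : F (L - j) ≤ F (L - (j + 1)) := hanti (by omega)
      exact this
    exact exists_linearIndepOn_extend_in (F (L - (j + 1))) hs (hsF.trans hmono)
  choose ext hext using step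
  -- recursive construction with invariants
  let R : (j : ℕ) → {s : Set V // LinearIndepOn K id s ∧ s ⊆ (F (L - j) : Set V) ∧ span K s = F (L - j)} :=
    fun j => Nat.rec (motive := fun j => {s : Set V // LinearIndepOn K id s ∧ s ⊆ (F (L - j) : Set V) ∧
        span K s = F (L - j)})
      ⟨∅, linearIndepOn_empty K id, Set.empty_subset _, by rw [Nat.sub_zero, hL, Submodule.span_empty]⟩
      (fun j prev => ⟨ext j prev.1 prev.2.1 prev.2.2.1,
        (hext j prev.1 prev.2.1 prev.2.2.1).2.2.2,
        (hext j prev.1 prev.2.1 prev.2.2.1).2.1,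
        (hext j prev.1 prev.2.1 prev.2.2.1).2.2.1⟩) j
  refine ⟨fun j => (R j).1, fun j => (R j).2.1, fun j => (R j).2.2.1, fun j => (R j).2.2.2, fun j => ?_⟩
  -- nestedness: R (j+1) = ext j (R j) … ⊇ R j
  show (R j).1 ⊆ (R (j + 1)).1
  exact (hext j (R j).1 (R j).2.1 (R j).2.2.1).1

/-- **Adapted basis for a descending chain (set form).**  For an antitone chain `F` of subspaces of a vector space
with `F 0 = ⊤` and `F L = ⊥` there are a linearly independent spanning set `B` and a level function `lvl : V → ℕ`
with: every `u ∈ B` lies in `F (lvl u)` and has `lvl u < L` (when `u ≠ 0`, automatic), and for every `t`,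
`F t ≤ span {u ∈ B | t ≤ lvl u}`. [folklore] -/
theorem exists_adapted_set (F : ℕ → Submodule K V) (hanti : Antitone F) (hF0 : F 0 = ⊤) (L : ℕ)
    (hL : F L = ⊥) :
    ∃ (B : Set V) (lvl : V → ℕ), LinearIndepOn K id B ∧ span K B = ⊤ ∧
      (∀ u ∈ B, u ∈ F (lvl u)) ∧ (∀ u ∈ B, lvl u ≤ L) ∧
      (∀ t, F t ≤ span K {u | u ∈ B ∧ t ≤ lvl u}) := by
  classical
  obtain ⟨S, hind, hsub, hspan, hnest⟩ := exists_nested_sets F hanti L hL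
  have hnest' : ∀ {j j'}, j ≤ j' → S j ⊆ S j' := by
    intro j j' hjj'
    induction hjj' with
    | refl => exact le_rfl
    | step _ ih => exact ih.trans (hnest _)
  refine ⟨S L, fun u => if h : ∃ j, u ∈ S j then L - Nat.find h else 0, hind L, ?_, ?_, ?_, ?_⟩
  · rw [hspan L, Nat.sub_self, hF0]
  · intro u hu
    have h : ∃ j, u ∈ S j := ⟨L, hu⟩
    simp only [dif_pos h]
    exact hsub (Nat.find h) (Nat.find_spec h)
  · intro u hu
    have h : ∃ j, u ∈ S j := ⟨L, hu⟩
    simp only [dif_pos h]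
    exact Nat.sub_le _ _
  · intro t
    by_cases ht : t ≤ L
    · -- F t = span (S (L - t)) and S (L - t) ⊆ {u ∈ S L | t ≤ lvl u}
      rw [show F t = span K (S (L - t)) by rw [hspan (L - t), show L - (L - t) = t by omega]]
      refine Submodule.span_mono fun u hu => ?_
      have huL : u ∈ S L := hnest' (Nat.sub_le L t) hu
      refine ⟨huL, ?_⟩
      have h : ∃ j, u ∈ S j := ⟨L - t, hu⟩
      simp only [dif_pos h]
      have hle : Nat.find h ≤ L - t := Nat.find_min' h hu
      omega
    · -- t > L: F t ≤ F L = ⊥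
      have : F t ≤ F L := hanti (by omega)
      rw [hL] at this
      exact this.trans bot_le

end AdaptedBasis

section LoewyFlag

variable {m : ℕ} (𝒜 : Subalgebra ℂ (Matrix (Fin m) (Fin m) ℂ))

/-- **Loewy flag of an ideal.**  For an ideal `J` of a matrix subalgebra `𝒜 ⊆ M_m(ℂ)` with `J ^ L = ⊥` there is an
antitone chain `F 0 = ⊤ ⊇ F 1 ⊇ ⋯ ⊇ F L = ⊥` of subspaces of `ℂ^m` (`F t = J^t · ℂ^m`) which every element of `𝒜`
preserves and along which every element of `J` climbs one step (`J · F t ⊆ F (t+1)`). [folklore] -/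
theorem exists_loewy_flag (J : Ideal 𝒜) {L : ℕ} (hL : J ^ L = ⊥) :
    ∃ F : ℕ → Submodule ℂ (Fin m → ℂ), Antitone F ∧ F 0 = ⊤ ∧ F L = ⊥ ∧
      (∀ t, ∀ b ∈ 𝒜, ∀ w ∈ F t, b.mulVec w ∈ F t) ∧
      (∀ t, ∀ a : 𝒜, a ∈ J → ∀ w ∈ F t, (a : Matrix (Fin m) (Fin m) ℂ).mulVec w ∈ F (t + 1)) := by
  classical
  -- `F t` = the span of all `a • w`, `a ∈ J^t`
  let F : ℕ → Submodule ℂ (Fin m → ℂ) := fun t =>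
    span ℂ {u | ∃ a : 𝒜, a ∈ J ^ t ∧ ∃ w : Fin m → ℂ, u = (a : Matrix (Fin m) (Fin m) ℂ).mulVec w}
  have hgen : ∀ t (a : 𝒜), a ∈ J ^ t → ∀ w, (a : Matrix (Fin m) (Fin m) ℂ).mulVec w ∈ F t :=
    fun t a ha w => subset_span ⟨a, ha, w, rfl⟩
  -- closure of `F t` under an endomorphism that maps generators into a span
  have hclosed : ∀ (t : ℕ) (b : Matrix (Fin m) (Fin m) ℂ) (G : Submodule ℂ (Fin m → ℂ)),
      (∀ (a : 𝒜), a ∈ J ^ t → ∀ w, b.mulVec ((a : Matrix (Fin m) (Fin m) ℂ).mulVec w) ∈ G) →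
      ∀ w ∈ F t, b.mulVec w ∈ G := by
    intro t b G hb w hw
    induction hw using Submodule.span_induction with
    | mem u hu =>
      obtain ⟨a, ha, w, rfl⟩ := hu
      exact hb a ha w
    | zero => rw [Matrix.mulVec_zero]; exact G.zero_mem
    | add u u' _ _ hu hu' => rw [Matrix.mulVec_add]; exact G.add_mem hu hu'
    | smul c u _ hu => rw [Matrix.mulVec_smul]; exact G.smul_mem c hu
  -- stability under `𝒜`
  have hstab : ∀ t, ∀ b ∈ 𝒜, ∀ w ∈ F t, b.mulVec w ∈ F t := by
    intro t b hb
    refine hclosed t b (F t) fun a ha w => ?_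
    rw [Matrix.mulVec_mulVec]
    have hba : (⟨b, hb⟩ * a : 𝒜) ∈ J ^ t := Ideal.mul_mem_left _ _ ha
    exact hgen t _ hba w
  -- climbing under `J`
  have hclimb : ∀ t, ∀ a : 𝒜, a ∈ J → ∀ w ∈ F t, (a : Matrix (Fin m) (Fin m) ℂ).mulVec w ∈ F (t + 1) := by
    intro t a ha
    rcases Nat.eq_zero_or_pos t with rfl | ht
    · intro w _
      have ha1 : a ∈ J ^ (0 + 1) := by rw [zero_add, Submodule.pow_one]; exact ha
      exact hgen (0 + 1) a ha1 w
    · refine hclosed t _ (F (t + 1)) fun a' ha' w => ?_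
      rw [Matrix.mulVec_mulVec]
      have hprod : a * a' ∈ J ^ (t + 1) := by
        rw [Submodule.pow_succ' J (Nat.pos_iff_ne_zero.1 ht)]
        exact Submodule.mul_mem_mul ha ha'
      exact hgen (t + 1) _ hprod w
  -- the chain is descending
  have hstep : ∀ t, F (t + 1) ≤ F t := by
    intro t
    refine span_le.2 ?_
    rintro u ⟨a, ha, w, rfl⟩
    -- `a ∈ J^(t+1) = J^t * J`: induct over the product structure
    rw [Submodule.pow_succ] at ha
    have key : ∀ c : 𝒜, c ∈ J ^ t * J → ∀ w, (c : Matrix (Fin m) (Fin m) ℂ).mulVec w ∈ F t := by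
      intro c hc
      refine Submodule.mul_induction_on
        (C := fun c : 𝒜 => ∀ w, (c : Matrix (Fin m) (Fin m) ℂ).mulVec w ∈ F t) hc ?_ ?_
      · intro p hp q _ w
        rw [Subalgebra.coe_mul, ← Matrix.mulVec_mulVec]
        exact hgen t p hp _
      · intro c c' hc hc' w
        rw [Subalgebra.coe_add, Matrix.add_mulVec]
        exact (F t).add_mem (hc w) (hc' w)
    exact key a ha w
  have hanti : Antitone F := by
    intro s t hst
    induction hst with
    | refl => exact le_rfl
    | step _ ih => exact (hstep _).trans ih
  refine ⟨F, hanti, ?_, ?_, hstab, hclimb⟩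
  · -- `F 0 = ⊤`: `1 ∈ J ^ 0`
    refine eq_top_iff.2 fun w _ => ?_
    have h1 : (1 : 𝒜) ∈ J ^ 0 := by
      rw [Submodule.pow_zero, Submodule.one_eq_span]
      exact Submodule.mem_span_singleton_self 1
    have := hgen 0 1 h1 w
    rwa [Subalgebra.coe_one, Matrix.one_mulVec] at this
  · -- `F L = ⊥`
    refine eq_bot_iff.2 (span_le.2 ?_)
    rintro u ⟨a, ha, w, rfl⟩
    rw [hL, Submodule.mem_bot] at ha
    rw [ha, Subalgebra.coe_zero, Matrix.zero_mulVec]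
    exact (Submodule.mem_bot ℂ).2 rfl

end LoewyFlag

end Summit.ValiantsHypothesis.ValiantsHypothesis.Theorems.GrenetZeon.RadicalCoarsening

end
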